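import Mathlib
import HarnessLib
import Literature.Probability.MarkovChains.CycleEigenfunctions
import Literature.Probability.MarkovChains.ConvergenceTheorem
import Literature.Probability.MarkovChains.RelaxationTime
import Literature.Probability.MarkovChains.SpectralGapVariational
import Literature.Probability.MarkovChains.AperiodicSpectralGap

/-!
# The walk on the `n`-cycle: irreducible, aperiodic iff `n` odd (Example 1.8); `λ₂, λ⋆ ≥ cos(2π/n)`, `γ ≤ 2π²/n²`, `γ⋆ = 0` for even `n` (Levin–Peres–Wilmer §12.3.1)

HONEST FRAMING: exact (Metropolis-corrected) sampling algorithms for lattice gauge theory; figures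
of merit are autocorrelation/cost numbers at stated couplings and volumes; no continuum-physics claim.

Conventions of `CycleEigenfunctions.lean` (`cycleWalk n` on `ZMod n`, `cycleEigenfun n j`, eq. (12.18)
`LevinPeres2017_eq_12_18`), `ConvergenceTheorem.lean` (`returnTimes`, `period`, `IsAperiodic`),
`PeskunOrdering.lean` (`IsIrreducible`), `RelaxationTime.lean` (`nontrivialEigenvalues`, `lambdaStar =
λ⋆`, `absSpectralGap = γ⋆`, `relaxationTime = t_rel`), `SpectralGapVariational.lean` (`orthEigenvalues`,
`secondEigenvalue = λ₂`, `spectralGap = γ`) and `AperiodicSpectralGap.lean` (`γ⋆ > 0` for irreducible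
aperiodic chains).  Source: D. A. Levin, Y. Peres (with E. L. Wilmer), *Markov Chains and Mixing
Times*, 2nd ed., AMS 2017 [LevinPeres2017], §1.3 Example 1.8 (p. 8) and §12.3.1 (pp. 165–166).
Everything is PROVED (0 named facts).  The stationary law is uniform (`cycleWalk_detailedBalance_uniform`).

* **EXAMPLE 1.8** `cycleWalk_isIrreducible` — "for every `n ≥ 1`, random walk on the `n`-cycle is
  irreducible"; `cycleWalk_period_eq_two_of_even`, `cycleWalk_not_isAperiodic_of_even` — "random
  walk on any even-length cycle is periodic, since `gcd{t : Pᵗ(x,x) > 0} = 2`" (parity of the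
  position flips at every step); `cycleWalk_isAperiodic_of_odd` — "random walk on an odd-length
  cycle is aperiodic" (`2, n ∈ T(x)`) [cite: LevinPeres2017, §1.3 Example 1.8];
* `cos_mem_nontrivialEigenvalues`, `cos_mem_orthEigenvalues` — `cos(2πj/n)` (when `≠ 1`) is an
  eigenvalue with eigenfunction `f_j ≢ 0`, `f_j ⊥_π 1` (Lemma 12.3) [cite: LevinPeres2017, §12.3.1
  eqs. (12.17)–(12.18) with §12.1 Lemma 12.3]; `sum_cycleEigenfun_eq_zero` — `Σ_k cos(2πjk/n) = 0`;
* **`cos_le_secondEigenvalue`, `cos_le_lambdaStar`** — `λ₂ ≥ cos(2πj/n)`, `λ⋆ ≥ cos(2πj/n)`; with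
  `j = 1` (`n ≥ 2`): **`spectralGap_cycleWalk_le`** `γ ≤ 1 − cos(2π/n)`,
  **`spectralGap_cycleWalk_le_sq`** `γ ≤ 2π²/n²`, `absSpectralGap_cycleWalk_le(_sq)` likewise for `γ⋆`
  [cite: LevinPeres2017, §12.3.1 ("`λ₂ = cos(2π/n) = 1 − 4π²/(2n²) + O(n⁻⁴)`, so the spectral gap `γ`
  is of order `n⁻²`")].  NOT CLAIMED: the equality `λ₂ = cos(2π/n)` and the matching lower bound on
  `γ` (they need the completeness of the `f_j`); only `λ₂ ≥ cos(2π/n)`, `γ ≤ 2π²/n²` are proved;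
* **`lambdaStar_cycleWalk_even`, `absSpectralGap_cycleWalk_even`** — for even `n = 2m`: `λ⋆ = 1`,
  **`γ⋆ = 0`** ("When `n = 2m` is even, `cos(2πm/n) = −1` is an eigenvalue, so `γ⋆ = 0`")
  [cite: LevinPeres2017, §12.3.1 (last paragraph)];
* `relaxationTime_cycleWalk_ge` — for odd `n ≥ 3`: `t_rel ≥ n²/(2π²)` (`γ⋆ > 0` by aperiodicity,
  `γ⋆ ≤ 2π²/n²`) [cite: LevinPeres2017, §12.3.1 with §12.2 (`t_rel = 1/γ⋆`)].

Context (cell pub-lqcd, venture LatticeQCDFlow): the `n²` lower bound on the relaxation time of the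
nearest-neighbour `ℤ_n` update is the reference diffusive scaling for single-link clock-model moves.
-/

namespace Literature.Probability.MarkovChains

open Finset Matrix

variable {n : ℕ} [NeZero n]

/-! ## Example 1.8: irreducibility and (a)periodicity -/

/-- The walk has non-negative entries. [cite: LevinPeres2017, §12.3.1 with §1.1] -/
theorem cycleWalk_nonneg (k l : ZMod n) : 0 ≤ cycleWalk n k l := cycleWalk_isRowStochastic.1 k l

omit [NeZero n] in
/-- `P(k, k+1) > 0`. [cite: LevinPeres2017, §1.3 Example 1.8 with Example 1.4] -/
theorem cycleWalk_apply_add_one_pos (k : ZMod n) : 0 < cycleWalk n k (k + 1) := by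
  rw [cycleWalk_apply, if_pos rfl]
  have : 0 ≤ (if k + 1 = k - 1 then (1 / 2 : ℝ) else 0) := by split_ifs <;> norm_num
  linarith

omit [NeZero n] in
/-- `P(k, k−1) > 0`. [cite: LevinPeres2017, §1.3 Example 1.8 with Example 1.4] -/
theorem cycleWalk_apply_sub_one_pos (k : ZMod n) : 0 < cycleWalk n k (k - 1) := by
  rw [cycleWalk_apply, if_pos (rfl : k - 1 = k - 1)]
  have : 0 ≤ (if k - 1 = k + 1 then (1 / 2 : ℝ) else 0) := by split_ifs <;> norm_num
  linarith

/-- A `t`-step path of positive probability: `Pᵗ(k, k + t) > 0`. [cite: LevinPeres2017, §1.3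
Example 1.8 ("random walk on the `n`-cycle is irreducible")] -/
theorem cycleWalk_pow_apply_pos (k : ZMod n) (t : ℕ) : 0 < (cycleWalk n ^ t) k (k + t) := by
  induction t with
  | zero => simp
  | succ t ih =>
    have h := pow_apply_mul_pow_apply_le cycleWalk_nonneg t 1 k (k + t) (k + t + 1)
    rw [pow_one] at h
    have h2 : (k : ZMod n) + ((t + 1 : ℕ) : ZMod n) = k + t + 1 := by
      push_cast
      ring
    rw [h2]
    exact (mul_pos ih (cycleWalk_apply_add_one_pos _)).trans_le h

/-- **EXAMPLE 1.8: "For every `n ≥ 1`, random walk on the `n`-cycle is irreducible."**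
[cite: LevinPeres2017, §1.3 Example 1.8] -/
theorem cycleWalk_isIrreducible : IsIrreducible (cycleWalk n) := fun x y => by
  refine ⟨(y - x).val, ?_⟩
  have h := cycleWalk_pow_apply_pos (n := n) x (y - x).val
  have e : x + (y - x) = y := by ring
  rwa [ZMod.natCast_zmod_val, e] at h

/-- `2 ∈ T(x)`: go to a neighbour and come back. [cite: LevinPeres2017, §1.3 Example 1.8] -/
theorem two_mem_returnTimes_cycleWalk (x : ZMod n) : 2 ∈ returnTimes (cycleWalk n) x := by
  refine ⟨by norm_num, ?_⟩
  have h := pow_apply_mul_pow_apply_le cycleWalk_nonneg 1 1 x (x + 1) x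
  rw [pow_one] at h
  have h1 : 0 < cycleWalk n (x + 1) x := by
    have := cycleWalk_apply_sub_one_pos (n := n) (x + 1)
    rwa [show x + 1 - 1 = x by ring] at this
  exact (mul_pos (cycleWalk_apply_add_one_pos x) h1).trans_le h

/-- `n ∈ T(x)`: once around the cycle. [cite: LevinPeres2017, §1.3 Example 1.8] -/
theorem self_mem_returnTimes_cycleWalk (x : ZMod n) : n ∈ returnTimes (cycleWalk n) x := by
  refine ⟨Nat.one_le_iff_ne_zero.mpr (NeZero.ne n), ?_⟩
  have h := cycleWalk_pow_apply_pos (n := n) x n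
  rwa [ZMod.natCast_self, add_zero] at h

/-- **EXAMPLE 1.8: "Random walk on an odd-length cycle is aperiodic"** (the period divides
`gcd(2, n) = 1`). [cite: LevinPeres2017, §1.3 Example 1.8] -/
theorem cycleWalk_isAperiodic_of_odd (hn : Odd n) : IsAperiodic (cycleWalk n) := fun x =>
  Nat.eq_one_of_dvd_coprimes (Nat.coprime_two_left.mpr hn)
    (period_dvd_of_mem (two_mem_returnTimes_cycleWalk x))
    (period_dvd_of_mem (self_mem_returnTimes_cycleWalk x))

/-- Parity bookkeeping on an even cycle `n = 2m`: the reduction mod `2` of the position changes by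
`1` at every step, so `Pᵗ(x,y) > 0` forces `ȳ = x̄ + t` in `ℤ/2`. [cite: LevinPeres2017, §1.3
Example 1.8 ("periodic, since `gcd{t : Pᵗ(x,x) > 0} = 2`", Figure 1.3)] -/
theorem castHom_eq_of_cycleWalk_pow_pos (m : ℕ) [NeZero (2 * m)] (t : ℕ) :
    ∀ x y : ZMod (2 * m), 0 < (cycleWalk (2 * m) ^ t) x y →
      ZMod.castHom (dvd_mul_right 2 m) (ZMod 2) y =
        ZMod.castHom (dvd_mul_right 2 m) (ZMod 2) x + t := by
  induction t with
  | zero =>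
    intro x y h
    rw [pow_zero, Matrix.one_apply] at h
    split_ifs at h with hxy
    · subst hxy
      simp
    · exact absurd h (lt_irrefl 0)
  | succ t ih =>
    intro x y h
    rw [pow_succ, Matrix.mul_apply] at h
    obtain ⟨z, -, hz⟩ := (sum_pos_iff_of_nonneg fun z _ => mul_nonneg
      (Matrix.pow_apply_nonneg cycleWalk_nonneg t x z) (cycleWalk_nonneg z y)).mp h
    have hz1 : 0 < (cycleWalk (2 * m) ^ t) x z := by
      rcases (Matrix.pow_apply_nonneg cycleWalk_nonneg t x z).eq_or_lt with h0 | h0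
      · rw [← h0, zero_mul] at hz
        exact absurd hz (lt_irrefl 0)
      · exact h0
    have hz2 : 0 < cycleWalk (2 * m) z y := by
      rcases (cycleWalk_nonneg z y).eq_or_lt with h0 | h0
      · rw [← h0, mul_zero] at hz
        exact absurd hz (lt_irrefl 0)
      · exact h0
    have hy : y = z + 1 ∨ y = z - 1 := by
      by_contra hcon
      rw [cycleWalk_apply, if_neg (fun h => hcon (Or.inl h)), if_neg (fun h => hcon (Or.inr h)),
        add_zero] at hz2
      exact lt_irrefl _ hz2
    have hxz := ih x z hz1
    rcases hy with rfl | rfl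
    · rw [map_add, map_one, hxz]
      push_cast
      ring
    · rw [map_sub, map_one, hxz]
      push_cast
      have h2 : (-1 : ZMod 2) = 1 := by decide
      linear_combination h2

/-- **EXAMPLE 1.8: "Random walk on any even-length cycle is periodic, since
`gcd{t : Pᵗ(x,x) > 0} = 2`."** [cite: LevinPeres2017, §1.3 Example 1.8] -/
theorem cycleWalk_period_eq_two_of_even (m : ℕ) [NeZero (2 * m)] (x : ZMod (2 * m)) :
    period (cycleWalk (2 * m)) x = 2 := by
  apply Nat.dvd_antisymm (period_dvd_of_mem (two_mem_returnTimes_cycleWalk x))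
  rw [dvd_period_iff]
  intro t ht
  have h := castHom_eq_of_cycleWalk_pow_pos m t x x ht.2
  have ht0 : ((t : ℕ) : ZMod 2) = 0 := by linear_combination -h
  exact (ZMod.natCast_eq_zero_iff t 2).mp ht0

/-- Hence the walk on an even cycle is not aperiodic. [cite: LevinPeres2017, §1.3 Example 1.8] -/
theorem cycleWalk_not_isAperiodic_of_even (m : ℕ) [NeZero (2 * m)] :
    ¬ IsAperiodic (cycleWalk (2 * m)) := fun h => by
  have h0 := h 0
  rw [cycleWalk_period_eq_two_of_even m 0] at h0
  exact absurd h0 (by norm_num)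

/-! ## The eigenvalues `cos(2πj/n)` sit in the spectrum: `λ₂, λ⋆ ≥ cos(2πj/n)` -/

omit [NeZero n] in
/-- `f_j ≢ 0` (`f_j(0) = 1`). [cite: LevinPeres2017, §12.3.1 eq. (12.18)] -/
theorem cycleEigenfun_ne_zero (j : ℕ) : cycleEigenfun n j ≠ 0 := fun h => by
  have h0 := congrFun h 0
  rw [cycleEigenfun_zero, Pi.zero_apply] at h0
  exact one_ne_zero h0

/-- The eigenvalue equation entrywise: `Σ_l P(k,l) f_j(l) = cos(2πj/n) f_j(k)`.
[cite: LevinPeres2017, §12.3.1 eqs. (12.16)–(12.18)] -/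
theorem sum_cycleWalk_mul_cycleEigenfun (j : ℕ) (k : ZMod n) :
    ∑ l, cycleWalk n k l * cycleEigenfun n j l =
      Real.cos (2 * Real.pi * j / n) * cycleEigenfun n j k := by
  have h := congrFun (LevinPeres2017_eq_12_18 (n := n) j) k
  simp only [mulVec, dotProduct, Pi.smul_apply, smul_eq_mul] at h
  exact h

/-- The same over `ℂ` (for the complexified spectrum of `RelaxationTime.lean`).
[cite: LevinPeres2017, §12.3.1 eqs. (12.16)–(12.18)] -/
theorem sum_cycleWalk_mul_cycleEigenfun_complex (j : ℕ) (k : ZMod n) :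
    ∑ l, (cycleWalk n k l : ℂ) * (cycleEigenfun n j l : ℂ) =
      ((Real.cos (2 * Real.pi * j / n) : ℝ) : ℂ) * (cycleEigenfun n j k : ℂ) := by
  exact_mod_cast sum_cycleWalk_mul_cycleEigenfun j k

/-- **`cos(2πj/n)` is an eigenvalue `≠ 1` of the walk** whenever `cos(2πj/n) ≠ 1`.
[cite: LevinPeres2017, §12.3.1 eq. (12.17)] -/
theorem cos_mem_nontrivialEigenvalues (j : ℕ) (hj : Real.cos (2 * Real.pi * j / n) ≠ 1) :
    ((Real.cos (2 * Real.pi * j / n) : ℝ) : ℂ) ∈ nontrivialEigenvalues (cycleWalk n) := by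
  refine ⟨?_, by exact_mod_cast hj⟩
  have hf0 : (fun k => (cycleEigenfun n j k : ℂ)) ≠ 0 := by
    intro h
    have h0 := congrFun h 0
    rw [cycleEigenfun_zero] at h0
    simp at h0
  exact Module.End.hasEigenvalue_of_hasEigenvector
    ((hasEigenvector_iff (cycleWalk n) _ _).mpr
      ⟨hf0, fun k => sum_cycleWalk_mul_cycleEigenfun_complex j k⟩)

/-- **`λ⋆ ≥ cos(2πj/n)`** (when `cos(2πj/n) ≠ 1`). [cite: LevinPeres2017, §12.3.1 with §12.2
eq. (12.6)] -/
theorem cos_le_lambdaStar (j : ℕ) (hj : Real.cos (2 * Real.pi * j / n) ≠ 1) :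
    Real.cos (2 * Real.pi * j / n) ≤ lambdaStar (cycleWalk n) := by
  have h := norm_le_lambdaStar (cos_mem_nontrivialEigenvalues j hj)
  rw [Complex.norm_real, Real.norm_eq_abs] at h
  exact (le_abs_self _).trans h

/-- **`Σ_k cos(2πjk/n) = 0`** whenever `cos(2πj/n) ≠ 1`: the eigenfunction `f_j` has mean zero under
the (uniform) stationary law, Lemma 12.3. [cite: LevinPeres2017, §12.1 Lemma 12.3 with §12.3.1
eq. (12.18)] -/
theorem sum_cycleEigenfun_eq_zero (j : ℕ) (hj : Real.cos (2 * Real.pi * j / n) ≠ 1) :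
    ∑ k, cycleEigenfun n j k = 0 := by
  have hst : IsStationary (fun _ : ZMod n => (1 : ℝ) / n) (cycleWalk n) :=
    cycleWalk_detailedBalance_uniform.isStationary cycleWalk_isRowStochastic.2
  have h := sum_mul_eigenfunction_eq_zero hst
    (fun k => sum_cycleWalk_mul_cycleEigenfun_complex (n := n) j k) (by exact_mod_cast hj)
  have h' : ∑ k, (1 : ℝ) / n * cycleEigenfun n j k = 0 := by exact_mod_cast h
  rw [← mul_sum] at h'
  rcases mul_eq_zero.mp h' with h0 | h0
  · exfalso
    rcases div_eq_zero_iff.mp h0 with h1 | h1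
    · exact one_ne_zero h1
    · exact (Nat.cast_ne_zero.mpr (NeZero.ne n)) h1
  · exact h0

/-- `cos(2πj/n)` (when `≠ 1`) is an eigenvalue carried by a real eigenfunction `⊥_π 1`.
[cite: LevinPeres2017, §12.3.1 eq. (12.18) with §12.1 Lemma 12.3] -/
theorem cos_mem_orthEigenvalues (j : ℕ) (hj : Real.cos (2 * Real.pi * j / n) ≠ 1) :
    Real.cos (2 * Real.pi * j / n) ∈ orthEigenvalues (fun _ : ZMod n => (1 : ℝ) / n) (cycleWalk n) :=
  ⟨cycleEigenfun n j, cycleEigenfun_ne_zero j,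
    by rw [← mul_sum, sum_cycleEigenfun_eq_zero j hj, mul_zero], LevinPeres2017_eq_12_18 j⟩

/-- The uniform law on `ZMod n` is a positive probability vector. [folklore] -/
private theorem uniform_pos_sum (n : ℕ) [NeZero n] :
    (∀ _ : ZMod n, (0 : ℝ) < 1 / n) ∧ ∑ _ : ZMod n, (1 : ℝ) / n = 1 := by
  have hn0 : (0 : ℝ) < n := Nat.cast_pos.mpr (NeZero.pos n)
  refine ⟨fun _ => div_pos one_pos hn0, ?_⟩
  rw [sum_const, card_univ, ZMod.card, nsmul_eq_mul]
  field_simp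

/-- **`λ₂ ≥ cos(2πj/n)`** (when `cos(2πj/n) ≠ 1`, `n ≥ 2`): by Lemma 13.7, `λ₂` is the largest
eigenvalue with an eigenfunction `⊥_π 1`. [cite: LevinPeres2017, §12.3.1 ("`λ₂ = cos(2π/n)`") with
§13.2.1 Lemma 13.7] -/
theorem cos_le_secondEigenvalue (hn : 2 ≤ n) (j : ℕ) (hj : Real.cos (2 * Real.pi * j / n) ≠ 1) :
    Real.cos (2 * Real.pi * j / n) ≤ secondEigenvalue (fun _ : ZMod n => (1 : ℝ) / n) (cycleWalk n) := by
  haveI : Fact (1 < n) := ⟨hn⟩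
  obtain ⟨hπ, hπ1⟩ := uniform_pos_sum n
  have h := le_of_mem_orthEigenvalues hπ cycleWalk_isRowStochastic
    (cycleWalk_detailedBalance_uniform.isStationary cycleWalk_isRowStochastic.2)
    (cos_mem_orthEigenvalues j hj)
  rw [← LevinPeres2017_lemma_13_7 hπ hπ1 cycleWalk_isRowStochastic
    cycleWalk_detailedBalance_uniform] at h
  unfold spectralGap at h
  linarith

omit [NeZero n] in
/-- `cos(2π/n) ≠ 1` for `n ≥ 2` (`0 < 2π/n < 2π`). [cite: LevinPeres2017, §12.3.1 (`λ₂ = cos(2π/n)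
< 1 = λ₁`)] -/
theorem cos_two_pi_div_ne_one (hn : 2 ≤ n) : Real.cos (2 * Real.pi / n) ≠ 1 := by
  have hn' : (2 : ℝ) ≤ n := by exact_mod_cast hn
  have hnpos : (0 : ℝ) < n := by linarith
  have hpos : 0 < 2 * Real.pi / n := div_pos Real.two_pi_pos hnpos
  have hlt : 2 * Real.pi / n < 2 * Real.pi := by
    rw [div_lt_iff₀ hnpos]
    nlinarith [Real.pi_pos]
  intro h
  have h0 := (Real.cos_eq_one_iff_of_lt_of_lt (by linarith) hlt).mp h
  linarith

/-- `1 − cos(2π/n) ≤ 2π²/n²` (`cos x ≥ 1 − x²/2`). [cite: LevinPeres2017, §12.3.1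
("`cos(2π/n) = 1 − 4π²/(2n²) + O(n⁻⁴)`")] -/
theorem one_sub_cos_two_pi_div_le (n : ℕ) :
    1 - Real.cos (2 * Real.pi / n) ≤ 2 * Real.pi ^ 2 / (n : ℝ) ^ 2 := by
  have h := Real.one_sub_sq_div_two_le_cos (x := 2 * Real.pi / n)
  have e : (2 * Real.pi / n) ^ 2 / 2 = 2 * Real.pi ^ 2 / (n : ℝ) ^ 2 := by ring
  linarith

/-- **`γ ≤ 1 − cos(2π/n)`** for the walk on the `n`-cycle (`n ≥ 2`). [cite: LevinPeres2017, §12.3.1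
("We have `λ₂ = cos(2π/n)` …, so the spectral gap `γ` is of order `n⁻²`")] -/
theorem spectralGap_cycleWalk_le (hn : 2 ≤ n) :
    spectralGap (fun _ : ZMod n => (1 : ℝ) / n) (cycleWalk n) ≤ 1 - Real.cos (2 * Real.pi / n) := by
  have hj : Real.cos (2 * Real.pi * ((1 : ℕ) : ℝ) / n) ≠ 1 := by
    simpa using cos_two_pi_div_ne_one hn
  have h := cos_le_secondEigenvalue hn 1 hj
  simp only [Nat.cast_one, mul_one] at h
  unfold spectralGap
  linarith

/-- **`γ ≤ 2π²/n²`** (`n ≥ 2`). [cite: LevinPeres2017, §12.3.1 ("the spectral gap `γ` is of order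
`n⁻²`")] -/
theorem spectralGap_cycleWalk_le_sq (hn : 2 ≤ n) :
    spectralGap (fun _ : ZMod n => (1 : ℝ) / n) (cycleWalk n) ≤ 2 * Real.pi ^ 2 / (n : ℝ) ^ 2 :=
  (spectralGap_cycleWalk_le hn).trans (one_sub_cos_two_pi_div_le n)

/-- **`γ⋆ ≤ 1 − cos(2π/n)`** (`n ≥ 2`). [cite: LevinPeres2017, §12.3.1 with §12.2 eq. (12.6)] -/
theorem absSpectralGap_cycleWalk_le (hn : 2 ≤ n) :
    absSpectralGap (cycleWalk n) ≤ 1 - Real.cos (2 * Real.pi / n) := by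
  have hj : Real.cos (2 * Real.pi * ((1 : ℕ) : ℝ) / n) ≠ 1 := by
    simpa using cos_two_pi_div_ne_one hn
  have h := cos_le_lambdaStar (n := n) 1 hj
  simp only [Nat.cast_one, mul_one] at h
  unfold absSpectralGap
  linarith

/-- **`γ⋆ ≤ 2π²/n²`** (`n ≥ 2`). [cite: LevinPeres2017, §12.3.1 with §12.2] -/
theorem absSpectralGap_cycleWalk_le_sq (hn : 2 ≤ n) :
    absSpectralGap (cycleWalk n) ≤ 2 * Real.pi ^ 2 / (n : ℝ) ^ 2 :=
  (absSpectralGap_cycleWalk_le hn).trans (one_sub_cos_two_pi_div_le n)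

/-! ## Even `n`: `γ⋆ = 0`; odd `n`: `t_rel ≥ n²/(2π²)` -/

/-- For even `n = 2m`, `−1` is an eigenvalue (eigenfunction `f_m`). [cite: LevinPeres2017, §12.3.1
(last paragraph)] -/
theorem neg_one_mem_nontrivialEigenvalues_of_even (m : ℕ) [NeZero (2 * m)] :
    (-1 : ℂ) ∈ nontrivialEigenvalues (cycleWalk (2 * m)) := by
  obtain ⟨hev, h0⟩ := LevinPeres2017_cycle_even m
  refine ⟨?_, by norm_num⟩
  have hf0 : (fun k => (cycleEigenfun (2 * m) m k : ℂ)) ≠ 0 := by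
    intro h
    have h1 := congrFun h 0
    rw [h0] at h1
    simp at h1
  refine Module.End.hasEigenvalue_of_hasEigenvector
    ((hasEigenvector_iff (cycleWalk (2 * m)) _ _).mpr ⟨hf0, fun k => ?_⟩)
  have hreal : ∑ l, cycleWalk (2 * m) k l * cycleEigenfun (2 * m) m l =
      (-1) * cycleEigenfun (2 * m) m k := by
    have h := congrFun hev k
    simp only [mulVec, dotProduct, Pi.smul_apply, smul_eq_mul] at h
    exact h
  exact_mod_cast hreal

/-- **"When `n = 2m` is even, `cos(2πm/n) = −1` is an eigenvalue, so `γ⋆ = 0`"**: `λ⋆ = 1`.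
[cite: LevinPeres2017, §12.3.1 (last paragraph)] -/
theorem lambdaStar_cycleWalk_even (m : ℕ) [NeZero (2 * m)] : lambdaStar (cycleWalk (2 * m)) = 1 := by
  apply le_antisymm (lambdaStar_le_one cycleWalk_isRowStochastic)
  have h := norm_le_lambdaStar (neg_one_mem_nontrivialEigenvalues_of_even m)
  rwa [norm_neg, norm_one] at h

/-- **`γ⋆ = 0` for the walk on an even cycle.** [cite: LevinPeres2017, §12.3.1 (last paragraph)] -/
theorem absSpectralGap_cycleWalk_even (m : ℕ) [NeZero (2 * m)] :
    absSpectralGap (cycleWalk (2 * m)) = 0 := by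
  unfold absSpectralGap
  rw [lambdaStar_cycleWalk_even m, sub_self]

/-- For an odd cycle `n ≥ 3`: `γ⋆ > 0` (irreducible and aperiodic) and **`t_rel = 1/γ⋆ ≥ n²/(2π²)`**.
[cite: LevinPeres2017, §12.3.1 ("the spectral gap is of order `n⁻²`") with §12.2 (`t_rel := 1/γ⋆`;
"if `P` is aperiodic and irreducible, then `γ⋆ > 0`") and §1.3 Example 1.8] -/
theorem relaxationTime_cycleWalk_ge (hn : Odd n) (hn3 : 3 ≤ n) :
    (n : ℝ) ^ 2 / (2 * Real.pi ^ 2) ≤ relaxationTime (cycleWalk n) := by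
  have hγ : 0 < absSpectralGap (cycleWalk n) :=
    absSpectralGap_pos cycleWalk_isRowStochastic cycleWalk_isIrreducible
      (cycleWalk_isAperiodic_of_odd hn)
  have hle := absSpectralGap_cycleWalk_le_sq (n := n) (by omega)
  unfold relaxationTime
  calc (n : ℝ) ^ 2 / (2 * Real.pi ^ 2) = 1 / (2 * Real.pi ^ 2 / (n : ℝ) ^ 2) := by
        rw [one_div_div]
    _ ≤ 1 / absSpectralGap (cycleWalk n) := one_div_le_one_div_of_le hγ hle

end Literature.Probability.MarkovChains
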